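import Summits.CriticalPhenomena.PercolationContinuityZ3.Theorems.Transplant.SkelFrmBChoiceHXV
import Summits.CriticalPhenomena.PercolationContinuityZ3.Theorems.Transplant.SkelFrmBChoiceArrivalYVR
import Summits.CriticalPhenomena.PercolationContinuityZ3.Theorems.Transplant.SkelFrmBChoiceArrivalYW
import Summits.CriticalPhenomena.PercolationContinuityZ3.Theorems.Transplant.SkelFrmBChoiceDepthYW
import Summits.CriticalPhenomena.PercolationContinuityZ3.Theorems.Transplant.SkelPhiCorridorKGYUnion
import HarnessLib

/-!
# N2 (frames-only node `SamePDropOfSkeletonFrm₁`, OPEN) — (ζ″) ledger under (R-44)/(R-45): **`HY` AT THE TUPLE OF RECORD, V CELLS** — the y′-axis value bundle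
# `NegB.HY_QV` that p5-g16's (C) column wrapper `reachHoldsRHNQL_choiceAtQ3V_of (HX) (HY)` consumes (SkelFrm1ReachHoldsQOfVK, frozen 2026-08-23T15:48:16Z),
# DISCHARGED from the era-3 value ledger at the V choices `choiceAtQ3V κ Φ t p Pv gv fv (SUS ex mx) (cR2W mk) (hFR mk) BSlot.small3 hC`

Shape (= p5's `HY` binder with `cv := cR2W mk`, `hv := hFR mk`, `bv := BSlot.small3`): `∀ O q, AtQNQ → ∃ ρ qq W HK N aW Bx bL, hρ1 ∧ hρ2 ∧ hρ3 ∧ hPR ∧ hLl ∧ ha ∧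
hBx ∧ hbL ∧ haWp ∧ haWm ∧ hbq ∧ (SchedYU.N ≤ LfQ κ.K₀) ∧ (∀ x, hLt)` over the union-prism y′ corridor (`kgCorrSchedYU`).
WITNESSES: `ρ := 0`, `qq := kgqY qxYQ4` (`= P + 19·sL + 43`, `kgqY_qxYQ4`), `W := kgWY WxYQ4` (= `98·n_L`, `kgWY_WxYQ4`), `HK := kgYRows0_of … hN hg` (CorrKG0),
`N := kgNYv0 …`, `(aW, Bx, bL) := (aWS, BxS, bLS) small3`.  ROWS (era 3, instance of record `(76·s₀, 19·s₁ | c0 + 5·s₁ + 2, c1 + 54·s₀ + 2)`): hρ1/hρ3 ⟸ the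
ex-floor `KS0.r₀0 t D mk (RLD …) + 3 ≤ ex` (as in `HX_QV`); hρ2 ⟸ `reachY_le_ZDYW` (DepthYW, `5 ≤ Kq`) + the ex-floor `ZDYW + 4 ≤ ex`; hPR = `hPRY_V'`
(RegionsYVR: per-phase boxes, rows `−5r₁+1 ≤ rdLo₁ ∧ rdHi₁ ≤ 22r₁−1` and the V room form `−hB 1 + 1 ≤ rdLo₀ ∧ rdHi₀ ≤ hF 1 − 1`, `hF 1 = c1 + 54·s₀ + 2`);
hLl = `hLlY_W` (ArrivalYW); ha/hBx/hbL = `ha_S/hBx_S/hb_S` (Window); haWp/haWm = `haW_b3` (Window3, `98·n_L ≤ (n_L ± v_L)⁺ + 98·n_L`); hbq = `hbq_b3`;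
budget = `kgSchedNY_le_LfQ3 (kgResY3_Q4)` (CorrKGLen3; `SchedYU.N = SchedY.N = N+1+m₁+1+m₂` by `rfl`); hLt = `hLtYV_Q` (§1: the y-step creep identity of the V
cells at `cR2vW` (`cenS_cR2vW_step1`, SkelFrmBChoiceHXV) + `hLtY_3` (CreepY3) + `hLtY_V'` (ArrivalYVR)).  FLOOR HYPOTHESES (discharged by the node file's residual
unions `Hg_Q/HexY_Q`, SkelFrmBChoiceResidQV): `Hg` as in `HX_QV`, `HexY : ∀ D g f, KS0.r₀0 t D mk (RLD …) + 3 ≤ ex … ∧ ZDYW … + 4 ≤ ex …` (ERA-3 y′ depth `ZDYW`).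
`hKq : 5 ≤ Neg.Kq κ` = the K-floor (R-42) (`Kmin ≥ 160`).
* §1 **`hLtYV_Q`**; §2 **`HY_QV`**.
NON-VACUITY (lead g11 standing order 03:52:56Z): `Hg`/`HexY` are max-floors on free residual slots (the node file's `gxQ/exQ` are the witnesses); every other
binder is `hLlY_W`'s set (`hKq`, `hN`, `hg`, `hg2`).
builds on p205010 (kernel theorem, internal audit signed; external expert review pending) — nothing in this file uses p205010; NOTHING is claimed about the open
node `SamePDropOfSkeletonFrm₁`.
Lane `prim-bschramm`, seat `prim-bschramm-stmt` (gen 22; T template stmt-g21); helper file (`--supports stmt-CriticalPhenomena-4575 --as helper`).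
[cite: KozmaNitzan2024, §4 Lemma 12 (pp. 23–25), p. 30 (Step IV)] [cite: MartineauTassion2017, §4.3 Lemma 4.2 (steering)]
-/

open scoped Classical

noncomputable section

namespace Summit.CriticalPhenomena.PercolationContinuityZ3.Theorems.Transplant

namespace PlanarSkeletonFrm

namespace NegB

open Literature.Probability.Percolation Literature.Probability.LatticeModels SimpleGraph
open SkelConc (Consts)
open Skelφ (shearUnit kgSL kgZY₀ kgZY₁ kgM₁Y kgM₂Y kgWm₂Y kgWp₂Y rdLo rdHi KGYRows kgCorrSchedY kgCorrSchedYU)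
open Skelφ.StepI (DataNS OutNS)
open BoxProdZ2 (Erad)
open TwoAxis.Para (modulus)
open Neg

/-! ## §1 The y′ across reading row in `HY`'s V shape -/

section Rows

variable {κ : Consts} {V : Type} [DecidableEq V] [Countable V] {G : SimpleGraph V} [G.LocallyFinite] {Φ : PlanarSkeletonFrm G} {t : V} {p : unitInterval}
  {D : Skelφ.StepI.DataNS V} {g f mk : ℕ}

/-- **THE (C) ACROSS READING ROW IN `HY`'S V SHAPE** (y′-corridor, at every cell `x` of the V cells at the creep/room values of record; `b 0 = small3 0 = 76·s₀`,
box `[arrLoY3, arrHiY3] = [kgLastLoY, kgLastHiY]` by `rfl`): `cenS (x+e₁) 0 − cenS x 0 − b₀ + 1 ≤ rdLo₀ ∧ rdHi₀ ≤ cenS (x+e₁) 0 − cenS x 0 + b₀ − 1 ∧ −hB 1 ≤ rdLo₀ ∧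
rdHi₀ ≤ hF 1`. [this work] -/
theorem hLtYV_Q (hKq : 5 ≤ Neg.Kq κ) (hN : EqNumL κ Φ t p D g f) (hg : gFloorKG κ Φ t p D mk ≤ g) (hg2 : 40 * Neg.K κ * KS0.R'0 κ Φ t p D mk ≤ g) (x : Site 2) :
    ((fcellsV κ Φ t p D g f (cR2vW κ Φ t p D g f mk) (hFRv κ Φ t p D g f mk))).cenS (x + stepVec (((1 : Fin 2), true) : MDir)) 0 - ((fcellsV κ Φ t p D g f (cR2vW κ Φ t p D g f mk) (hFRv κ Φ t p D g f mk))).cenS x 0 - ((BSlot.small3 κ Φ t p D g f 0 : ℕ) : ℤ) + 1 ≤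
        rdLo (Aof κ) (nL κ Φ t p D g f) (hL κ Φ t p D g f) (vL κ Φ t p D g f) (vβL κ Φ t p D g f) (prFA κ Φ t p D g f).c₀ (prFA κ Φ t p D g f).c₁ (prFA κ Φ t p D g f).D (arrLoY3 κ Φ t p D g f mk) (arrHiY3 κ Φ t p D g f mk) 0 ∧
      rdHi (Aof κ) (nL κ Φ t p D g f) (hL κ Φ t p D g f) (vL κ Φ t p D g f) (vβL κ Φ t p D g f) (prFA κ Φ t p D g f).c₀ (prFA κ Φ t p D g f).c₁ (prFA κ Φ t p D g f).D (arrLoY3 κ Φ t p D g f mk) (arrHiY3 κ Φ t p D g f mk) 0 ≤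
        ((fcellsV κ Φ t p D g f (cR2vW κ Φ t p D g f mk) (hFRv κ Φ t p D g f mk))).cenS (x + stepVec (((1 : Fin 2), true) : MDir)) 0 - ((fcellsV κ Φ t p D g f (cR2vW κ Φ t p D g f mk) (hFRv κ Φ t p D g f mk))).cenS x 0 + ((BSlot.small3 κ Φ t p D g f 0 : ℕ) : ℤ) - 1 ∧
      -((((fcellsV κ Φ t p D g f (cR2vW κ Φ t p D g f mk) (hFRv κ Φ t p D g f mk))).hB 1 : ℕ) : ℤ) ≤ rdLo (Aof κ) (nL κ Φ t p D g f) (hL κ Φ t p D g f) (vL κ Φ t p D g f) (vβL κ Φ t p D g f) (prFA κ Φ t p D g f).c₀ (prFA κ Φ t p D g f).c₁ (prFA κ Φ t p D g f).D (arrLoY3 κ Φ t p D g f mk) (arrHiY3 κ Φ t p D g f mk) 0 ∧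
      rdHi (Aof κ) (nL κ Φ t p D g f) (hL κ Φ t p D g f) (vL κ Φ t p D g f) (vβL κ Φ t p D g f) (prFA κ Φ t p D g f).c₀ (prFA κ Φ t p D g f).c₁ (prFA κ Φ t p D g f).D (arrLoY3 κ Φ t p D g f mk) (arrHiY3 κ Φ t p D g f mk) 0 ≤ ((((fcellsV κ Φ t p D g f (cR2vW κ Φ t p D g f mk) (hFRv κ Φ t p D g f mk))).hF 1 : ℕ) : ℤ) := by
  rw [cenS_cR2vW_step1 (hFRv κ Φ t p D g f mk) hKq hN hg hg2 x]
  obtain ⟨h1, h2, -, -⟩ := hLtY_3 κ Φ t p D g f mk hKq hN hg hg2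
  obtain ⟨h3, h4⟩ := hLtY_V' κ Φ t p D g f mk (cR2vW κ Φ t p D g f mk) hKq hN hg hg2
  exact ⟨h1, h2, h3, h4⟩

end Rows

/-! ## §2 `HY` at the tuple of record (V cells) -/

section HY

variable {κ : Consts} {V : Type} [DecidableEq V] [Countable V] {G : SimpleGraph V} [G.LocallyFinite] {Φ : PlanarSkeletonFrm G} {t : V} {p : unitInterval}
  {hC : Φ.CylSubcritical p} {gv fv : Neg.FSlot} {Pv : PSlot} {ex mx : GSlot}

/-- **`HY` AT THE TUPLE OF RECORD, V CELLS** (y′-axis bundle of p5-g16's (C) wrapper `reachHoldsRHNQL_choiceAtQ3V_of`, every conjunct from the era-3 value ledger;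
see the module docstring for the row ↦ provider map). [cite: KozmaNitzan2024, §4 Lemma 12 (pp. 23–25), p. 30] -/
theorem HY_QV (mk : ℕ) (hKq : 5 ≤ Neg.Kq κ) (Hg : ∀ D : DataNS V, gFloorKG κ Φ t p D mk ≤ gv κ Φ t p D ∧ 40 * Neg.K κ * KS0.R'0 κ Φ t p D mk ≤ gv κ Φ t p D)
    (HexY : ∀ (D : DataNS V) (g f : ℕ), KS0.r₀0 t D mk (RLD κ Φ t p D g f) + 3 ≤ ex κ Φ t p D g f ∧ ZDYW κ Φ t p D g f + 4 ≤ ex κ Φ t p D g f)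
    (O : OutNS V) (q : unitInterval) (hAt : (choiceAtQ3V κ Φ t p Pv gv fv (SUS ex mx) (cR2W mk) (hFR mk) BSlot.small3 hC).AtQNQ O q) :
      ∃ (ρ qq W : ℕ) (HK : Skelφ.KGYRows (nL κ Φ t p O.merged (gOf κ Φ t p O gv) (fOf κ Φ t p O fv)) (ℓL κ Φ t p O.merged (gOf κ Φ t p O gv) (fOf κ Φ t p O fv)) (hL κ Φ t p O.merged (gOf κ Φ t p O gv) (fOf κ Φ t p O fv)) (vL κ Φ t p O.merged (gOf κ Φ t p O gv) (fOf κ Φ t p O fv)) (KS0.R'0 κ Φ t p O.merged mk) ρ qq W) (N : ℕ) (aW Bx bL : ℤ),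
      (KS0.r₀0 t O.merged mk (RL κ Φ t p O gv fv) + 3 ≤ Skelφ.Prm.E₀ (SUS ex mx κ Φ t p O.merged (gOf κ Φ t p O gv) (fOf κ Φ t p O fv) q)) ∧
      ((13 : ℤ) * (((N : ℤ) + 1) * (((nL κ Φ t p O.merged (gOf κ Φ t p O gv) (fOf κ Φ t p O fv)) * (ℓL κ Φ t p O.merged (gOf κ Φ t p O gv) (fOf κ Φ t p O fv)) / Skelφ.shearUnit (nL κ Φ t p O.merged (gOf κ Φ t p O gv) (fOf κ Φ t p O fv)) (hL κ Φ t p O.merged (gOf κ Φ t p O gv) (fOf κ Φ t p O fv)) + 1 : ℕ) : ℤ) + Skelφ.kgZY₀ (nL κ Φ t p O.merged (gOf κ Φ t p O gv) (fOf κ Φ t p O fv)) (vL κ Φ t p O.merged (gOf κ Φ t p O gv) (fOf κ Φ t p O fv)) (KS0.R'0 κ Φ t p O.merged mk) ρ W N (Skelφ.kgM₁Y (nL κ Φ t p O.merged (gOf κ Φ t p O gv) (fOf κ Φ t p O fv)) (vL κ Φ t p O.merged (gOf κ Φ t p O gv) (fOf κ Φ t p O fv)) (KS0.R'0 κ Φ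 t p O.merged mk) ρ W N) (Skelφ.kgWm₂Y (nL κ Φ t p O.merged (gOf κ Φ t p O gv) (fOf κ Φ t p O fv)) (vL κ Φ t p O.merged (gOf κ Φ t p O gv) (fOf κ Φ t p O fv)) (KS0.R'0 κ Φ t p O.merged mk) ρ W N) (Skelφ.kgWp₂Y (nL κ Φ t p O.merged (gOf κ Φ t p O gv) (fOf κ Φ t p O fv)) (vL κ Φ t p O.merged (gOf κ Φ t p O gv) (fOf κ Φ t p O fv)) (KS0.R'0 κ Φ t p O.merged mk) ρ W N) (Skelφ.kgM₂Y (nL κ Φ t p O.merged (gOf κ Φ t p O gv) (fOf κ Φ t p O fv)) (ℓL κ Φ t p O.merged (gOf κ Φ t p O gv) (fOf κ Φ t p O fv)) (hL κ Φ t p O.merged (gOf κ Φ t p O gv) (fOf κ Φ t p O fv)) (vL κ Φ t p O.merged (gOf κ Φ t p O gv) (fOf κ Φ t p O fv)) (KS0.R'0 κ Φ t p O.merged mk) ρ qq W N) + Skelφ.kgZY₁ (nL κ Φ t p O.merged (gOf κ Φ t p O gv) (fOf κ Φ t p O fv)) (ℓL κ Φ t p O.merged (gOf κ Φ t p O gv)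 (fOf κ Φ t p O fv)) (hL κ Φ t p O.merged (gOf κ Φ t p O gv) (fOf κ Φ t p O fv)) (KS0.R'0 κ Φ t p O.merged mk) ρ qq N (Skelφ.kgM₁Y (nL κ Φ t p O.merged (gOf κ Φ t p O gv) (fOf κ Φ t p O fv)) (vL κ Φ t p O.merged (gOf κ Φ t p O gv) (fOf κ Φ t p O fv)) (KS0.R'0 κ Φ t p O.merged mk) ρ W N) (Skelφ.kgM₂Y (nL κ Φ t p O.merged (gOf κ Φ t p O gv) (fOf κ Φ t p O fv)) (ℓL κ Φ t p O.merged (gOf κ Φ t p O gv) (fOf κ Φ t p O fv)) (hL κ Φ t p O.merged (gOf κ Φ t p O gv) (fOf κ Φ t p O fv)) (vL κ Φ t p O.merged (gOf κ Φ t p O gv) (fOf κ Φ t p O fv)) (KS0.R'0 κ Φ t p O.merged mk) ρ qq W N)) + 4 ≤ (Skelφ.Prm.E₀ (SUS ex mx κ Φ t p O.merged (gOf κ Φ t p O gv) (fOf κ Φ t p O fv) q) : ℤ)) ∧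
      (∀ k : ℕ, (SUS ex mx κ Φ t p O.merged (gOf κ Φ t p O gv) (fOf κ Φ t p O fv) q).Rex (Erad (Skelφ.Prm.gap (SUS ex mx κ Φ t p O.merged (gOf κ Φ t p O gv) (fOf κ Φ t p O fv) q)) (fun _ => 0) (Skelφ.Prm.E₀ (SUS ex mx κ Φ t p O.merged (gOf κ Φ t p O gv) (fOf κ Φ t p O fv) q)) k) + KS0.r₀0 t O.merged mk (RL κ Φ t p O gv fv) + 3 ≤
      Skelφ.Prm.gap (SUS ex mx κ Φ t p O.merged (gOf κ Φ t p O gv) (fOf κ Φ t p O fv) q) (Erad (Skelφ.Prm.gap (SUS ex mx κ Φ t p O.merged (gOf κ Φ t p O gv) (fOf κ Φ t p O fv) q)) (fun _ => 0) (Skelφ.Prm.E₀ (SUS ex mx κ Φ t p O.merged (gOf κ Φ t p O gv) (fOf κ Φ t p O fv) q)) k)) ∧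
      (∀ k ≤ (Skelφ.kgCorrSchedY HK.hn HK.hv HK.hlay (HK.kgYVals_ok₁ N) (HK.kgYVals_ok₂ N) (HK.kgYVals_split N)).N, ∃ lo hi : Site 2,
      (Skelφ.kgCorrSchedY HK.hn HK.hv HK.hlay (HK.kgYVals_ok₁ N) (HK.kgYVals_ok₂ N) (HK.kgYVals_split N)).region k ⊆ Finset.Icc lo hi ∧
      (-(5 * (((fcellsV κ Φ t p O.merged (gOf κ Φ t p O gv) (fOf κ Φ t p O fv) (cOf κ Φ t p O gv fv (cR2W mk)) (hOf κ Φ t p O gv fv (hFR mk)))).r 1 : ℤ)) + 1 ≤ Skelφ.rdLo ((prFA κ Φ t p O.merged (gOf κ Φ t p O gv) (fOf κ Φ t p O fv))).A (nL κ Φ t p O.merged (gOf κ Φ t p O gv) (fOf κ Φ t p O fv)) (hL κ Φ t p O.merged (gOf κ Φ t p O gv) (fOf κ Φ t p O fv)) (vL κ Φ t p O.merged (gOf κ Φ t p O gv) (fOf κ Φ t p O fv)) (vβL κ Φ t p O.merged (gOf κ Φ t p O gv) (fOf κ Φ t p O fv)) ((prFA κ Φ t p O.merged (gOf κ Φ t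 p O gv) (fOf κ Φ t p O fv))).c₀ ((prFA κ Φ t p O.merged (gOf κ Φ t p O gv) (fOf κ Φ t p O fv))).c₁ ((prFA κ Φ t p O.merged (gOf κ Φ t p O gv) (fOf κ Φ t p O fv))).D lo hi 1 ∧
        Skelφ.rdHi ((prFA κ Φ t p O.merged (gOf κ Φ t p O gv) (fOf κ Φ t p O fv))).A (nL κ Φ t p O.merged (gOf κ Φ t p O gv) (fOf κ Φ t p O fv)) (hL κ Φ t p O.merged (gOf κ Φ t p O gv) (fOf κ Φ t p O fv)) (vL κ Φ t p O.merged (gOf κ Φ t p O gv) (fOf κ Φ t p O fv)) (vβL κ Φ t p O.merged (gOf κ Φ t p O gv) (fOf κ Φ t p O fv)) ((prFA κ Φ t p O.merged (gOf κ Φ t p O gv) (fOf κ Φ t p O fv))).c₀ ((prFA κ Φ t p O.merged (gOf κ Φ t p O gv) (fOf κ Φ t p O fv))).c₁ ((prFA κ Φ t p O.merged (gOf κ Φ t p O gv) (fOf κ Φ t p O fv))).D lo hi 1 ≤ 22 * (((fcellsV κ Φ t p O.merged (gOf κ Φ t p O gv) (fOf κ Φ t p O fv) (cOf κ Φ t p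 O gv fv (cR2W mk)) (hOf κ Φ t p O gv fv (hFR mk)))).r 1 : ℤ) - 1) ∧
      (-(((fcellsV κ Φ t p O.merged (gOf κ Φ t p O gv) (fOf κ Φ t p O fv) (cOf κ Φ t p O gv fv (cR2W mk)) (hOf κ Φ t p O gv fv (hFR mk)))).hB 1 : ℤ) + 1 ≤ Skelφ.rdLo ((prFA κ Φ t p O.merged (gOf κ Φ t p O gv) (fOf κ Φ t p O fv))).A (nL κ Φ t p O.merged (gOf κ Φ t p O gv) (fOf κ Φ t p O fv)) (hL κ Φ t p O.merged (gOf κ Φ t p O gv) (fOf κ Φ t p O fv)) (vL κ Φ t p O.merged (gOf κ Φ t p O gv) (fOf κ Φ t p O fv)) (vβL κ Φ t p O.merged (gOf κ Φ t p O gv) (fOf κ Φ t p O fv)) ((prFA κ Φ t p O.merged (gOf κ Φ t p O gv) (fOf κ Φ t p O fv))).c₀ ((prFA κ Φ t p O.merged (gOf κ Φ t p O gv) (fOf κ Φ t p O fv))).c₁ ((prFA κ Φ t p O.merged (gOf κ Φ t p O gv) (fOf κ Φ t p O fv))).D lo hi 0 ∧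
        Skelφ.rdHi ((prFA κ Φ t p O.merged (gOf κ Φ t p O gv) (fOf κ Φ t p O fv))).A (nL κ Φ t p O.merged (gOf κ Φ t p O gv) (fOf κ Φ t p O fv)) (hL κ Φ t p O.merged (gOf κ Φ t p O gv) (fOf κ Φ t p O fv)) (vL κ Φ t p O.merged (gOf κ Φ t p O gv) (fOf κ Φ t p O fv)) (vβL κ Φ t p O.merged (gOf κ Φ t p O gv) (fOf κ Φ t p O fv)) ((prFA κ Φ t p O.merged (gOf κ Φ t p O gv) (fOf κ Φ t p O fv))).c₀ ((prFA κ Φ t p O.merged (gOf κ Φ t p O gv) (fOf κ Φ t p O fv))).c₁ ((prFA κ Φ t p O.merged (gOf κ Φ t p O gv) (fOf κ Φ t p O fv))).D lo hi 0 ≤ (((fcellsV κ Φ t p O.merged (gOf κ Φ t p O gv) (fOf κ Φ t p O fv) (cOf κ Φ t p O gv fv (cR2W mk)) (hOf κ Φ t p O gv fv (hFR mk)))).hF 1 : ℤ) - 1)) ∧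
      (20 * (((fcellsV κ Φ t p O.merged (gOf κ Φ t p O gv) (fOf κ Φ t p O fv) (cOf κ Φ t p O gv fv (cR2W mk)) (hOf κ Φ t p O gv fv (hFR mk)))).r 1 : ℤ) - (bOf κ Φ t p O gv fv BSlot.small3) 1 + 1 ≤ Skelφ.rdLo ((prFA κ Φ t p O.merged (gOf κ Φ t p O gv) (fOf κ Φ t p O fv))).A (nL κ Φ t p O.merged (gOf κ Φ t p O gv) (fOf κ Φ t p O fv)) (hL κ Φ t p O.merged (gOf κ Φ t p O gv) (fOf κ Φ t p O fv)) (vL κ Φ t p O.merged (gOf κ Φ t p O gv) (fOf κ Φ t p O fv)) (vβL κ Φ t p O.merged (gOf κ Φ t p O gv) (fOf κ Φ t p O fv)) ((prFA κ Φ t p O.merged (gOf κ Φ t p O gv) (fOf κ Φ t p O fv))).c₀ ((prFA κ Φ t p O.merged (gOf κ Φ t p O gv) (fOf κ Φ t p O fv))).c₁ ((prFA κ Φ t p O.merged (gOf κ Φ t p O gv) (fOf κ Φ t p O fv))).D (HK.kgLastLoY N) (HK.kgLastHiY N) 1 ∧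
      5 * (((fcellsV κ Φ t p O.merged (gOf κ Φ t p O gv) (fOf κ Φ t p O fv) (cOf κ Φ t p O gv fv (cR2W mk)) (hOf κ Φ t p O gv fv (hFR mk)))).r 1 : ℤ) ≤ Skelφ.rdLo ((prFA κ Φ t p O.merged (gOf κ Φ t p O gv) (fOf κ Φ t p O fv))).A (nL κ Φ t p O.merged (gOf κ Φ t p O gv) (fOf κ Φ t p O fv)) (hL κ Φ t p O.merged (gOf κ Φ t p O gv) (fOf κ Φ t p O fv)) (vL κ Φ t p O.merged (gOf κ Φ t p O gv) (fOf κ Φ t p O fv)) (vβL κ Φ t p O.merged (gOf κ Φ t p O gv) (fOf κ Φ t p O fv)) ((prFA κ Φ t p O.merged (gOf κ Φ t p O gv) (fOf κ Φ t p O fv))).c₀ ((prFA κ Φ t p O.merged (gOf κ Φ t p O gv) (fOf κ Φ t p O fv))).c₁ ((prFA κ Φ t p O.merged (gOf κ Φ t p O gv) (fOf κ Φ t p O fv))).D (HK.kgLastLoY N) (HK.kgLastHiY N) 1 ∧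
      Skelφ.rdHi ((prFA κ Φ t p O.merged (gOf κ Φ t p O gv) (fOf κ Φ t p O fv))).A (nL κ Φ t p O.merged (gOf κ Φ t p O gv) (fOf κ Φ t p O fv)) (hL κ Φ t p O.merged (gOf κ Φ t p O gv) (fOf κ Φ t p O fv)) (vL κ Φ t p O.merged (gOf κ Φ t p O gv) (fOf κ Φ t p O fv)) (vβL κ Φ t p O.merged (gOf κ Φ t p O gv) (fOf κ Φ t p O fv)) ((prFA κ Φ t p O.merged (gOf κ Φ t p O gv) (fOf κ Φ t p O fv))).c₀ ((prFA κ Φ t p O.merged (gOf κ Φ t p O gv) (fOf κ Φ t p O fv))).c₁ ((prFA κ Φ t p O.merged (gOf κ Φ t p O gv) (fOf κ Φ t p O fv))).D (HK.kgLastLoY N) (HK.kgLastHiY N) 1 ≤ 20 * (((fcellsV κ Φ t p O.merged (gOf κ Φ t p O gv) (fOf κ Φ t p O fv) (cOf κ Φ t p O gv fv (cR2W mk)) (hOf κ Φ t p O gv fv (hFR mk)))).r 1 : ℤ) + (bOf κ Φ t p O gv fv BSlot.small3) 1 - 1 ∧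
      Skelφ.rdHi ((prFA κ Φ t p O.merged (gOf κ Φ t p O gv) (fOf κ Φ t p O fv))).A (nL κ Φ t p O.merged (gOf κ Φ t p O gv) (fOf κ Φ t p O fv)) (hL κ Φ t p O.merged (gOf κ Φ t p O gv) (fOf κ Φ t p O fv)) (vL κ Φ t p O.merged (gOf κ Φ t p O gv) (fOf κ Φ t p O fv)) (vβL κ Φ t p O.merged (gOf κ Φ t p O gv) (fOf κ Φ t p O fv)) ((prFA κ Φ t p O.merged (gOf κ Φ t p O gv) (fOf κ Φ t p O fv))).c₀ ((prFA κ Φ t p O.merged (gOf κ Φ t p O gv) (fOf κ Φ t p O fv))).c₁ ((prFA κ Φ t p O.merged (gOf κ Φ t p O gv) (fOf κ Φ t p O fv))).D (HK.kgLastLoY N) (HK.kgLastHiY N) 1 ≤ 22 * (((fcellsV κ Φ t p O.merged (gOf κ Φ t p O gv) (fOf κ Φ t p O fv) (cOf κ Φ t p O gv fv (cR2W mk)) (hOf κ Φ t p O gv fv (hFR mk)))).r 1 : ℤ)) ∧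
      (((prFA κ Φ t p O.merged (gOf κ Φ t p O gv) (fOf κ Φ t p O fv))).D * (((prFA κ Φ t p O.merged (gOf κ Φ t p O gv) (fOf κ Φ t p O fv))).c₁ * ((nL κ Φ t p O.merged (gOf κ Φ t p O gv) (fOf κ Φ t p O fv)) : ℤ) * ((bOf κ Φ t p O gv fv BSlot.small3) 0 + 1) + ((prFA κ Φ t p O.merged (gOf κ Φ t p O gv) (fOf κ Φ t p O fv))).c₀ * |(vL κ Φ t p O.merged (gOf κ Φ t p O gv) (fOf κ Φ t p O fv))| * ((bOf κ Φ t p O gv fv BSlot.small3) 1 + 1)) ≤ ((prFA κ Φ t p O.merged (gOf κ Φ t p O gv) (fOf κ Φ t p O fv))).c₀ * ((prFA κ Φ t p O.merged (gOf κ Φ t p O gv) (fOf κ Φ t p O fv))).c₁ * ((prFA κ Φ t p O.merged (gOf κ Φ t p O gv) (fOf κ Φ t p O fv))).A * modulus (nL κ Φ t p O.merged (gOf κ Φ t p O gv) (fOf κ Φ t p O fv)) (hL κ Φ t p O.merged (gOf κ Φ t p O gv) (fOf κ Φ t p O fv)) (vL κ Φ t p O.merged (gOf κ Φ t p O gv)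 (fOf κ Φ t p O fv)) (vβL κ Φ t p O.merged (gOf κ Φ t p O gv) (fOf κ Φ t p O fv)) * aW) ∧
      (((prFA κ Φ t p O.merged (gOf κ Φ t p O gv) (fOf κ Φ t p O fv))).D * (((bOf κ Φ t p O gv fv BSlot.small3) 1 : ℤ) + 1) ≤ ((prFA κ Φ t p O.merged (gOf κ Φ t p O gv) (fOf κ Φ t p O fv))).c₁ * ((prFA κ Φ t p O.merged (gOf κ Φ t p O gv) (fOf κ Φ t p O fv))).A * Bx) ∧
      (Bx / (Skelφ.shearUnit (nL κ Φ t p O.merged (gOf κ Φ t p O gv) (fOf κ Φ t p O fv)) (hL κ Φ t p O.merged (gOf κ Φ t p O gv) (fOf κ Φ t p O fv)) : ℤ) + 1 ≤ bL) ∧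
      (aW ≤ (((((nL κ Φ t p O.merged (gOf κ Φ t p O gv) (fOf κ Φ t p O fv)) : ℤ) + (vL κ Φ t p O.merged (gOf κ Φ t p O gv) (fOf κ Φ t p O fv))).toNat + W : ℕ) : ℤ)) ∧
      (aW ≤ (((((nL κ Φ t p O.merged (gOf κ Φ t p O gv) (fOf κ Φ t p O fv)) : ℤ) - (vL κ Φ t p O.merged (gOf κ Φ t p O gv) (fOf κ Φ t p O fv))).toNat + W : ℕ) : ℤ)) ∧
      (bL ≤ qq) ∧
      ((Skelφ.kgCorrSchedYU HK.hn HK.hv HK.hlay (HK.kgYVals_ok₁ N) (HK.kgYVals_ok₂ N) (HK.kgYVals_split N)).N ≤ NegB.LfQ κ.K₀) ∧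
      (∀ x : Site 2, (fcellsV κ Φ t p O.merged (gOf κ Φ t p O gv) (fOf κ Φ t p O fv) (cOf κ Φ t p O gv fv (cR2W mk)) (hOf κ Φ t p O gv fv (hFR mk))).cenS (x + stepVec (((1 : Fin 2), true) : MDir)) 0 - (fcellsV κ Φ t p O.merged (gOf κ Φ t p O gv) (fOf κ Φ t p O fv) (cOf κ Φ t p O gv fv (cR2W mk)) (hOf κ Φ t p O gv fv (hFR mk))).cenS x 0 - (bOf κ Φ t p O gv fv BSlot.small3) 0 + 1 ≤ Skelφ.rdLo ((prFA κ Φ t p O.merged (gOf κ Φ t p O gv) (fOf κ Φ t p O fv))).A (nL κ Φ t p O.merged (gOf κ Φ t p O gv) (fOf κ Φ t p O fv)) (hL κ Φ t p O.merged (gOf κ Φ t p O gv) (fOf κ Φ t p O fv)) (vL κ Φ t p O.merged (gOf κ Φ t p O gv) (fOf κ Φ t p O fv)) (vβL κ Φ t p O.merged (gOf κ Φ t p O gv) (fOf κ Φ t p O fv)) ((prFA κ Φ t p O.merged (gOf κ Φ t p O gv) (fOf κ Φ t p O fv))).c₀ ((prFA κ Φ t p O.merged (gOf κ Φ t p O gv)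 (fOf κ Φ t p O fv))).c₁ ((prFA κ Φ t p O.merged (gOf κ Φ t p O gv) (fOf κ Φ t p O fv))).D (HK.kgLastLoY N) (HK.kgLastHiY N) 0 ∧
      Skelφ.rdHi ((prFA κ Φ t p O.merged (gOf κ Φ t p O gv) (fOf κ Φ t p O fv))).A (nL κ Φ t p O.merged (gOf κ Φ t p O gv) (fOf κ Φ t p O fv)) (hL κ Φ t p O.merged (gOf κ Φ t p O gv) (fOf κ Φ t p O fv)) (vL κ Φ t p O.merged (gOf κ Φ t p O gv) (fOf κ Φ t p O fv)) (vβL κ Φ t p O.merged (gOf κ Φ t p O gv) (fOf κ Φ t p O fv)) ((prFA κ Φ t p O.merged (gOf κ Φ t p O gv) (fOf κ Φ t p O fv))).c₀ ((prFA κ Φ t p O.merged (gOf κ Φ t p O gv) (fOf κ Φ t p O fv))).c₁ ((prFA κ Φ t p O.merged (gOf κ Φ t p O gv) (fOf κ Φ t p O fv))).D (HK.kgLastLoY N) (HK.kgLastHiY N) 0 ≤ (fcellsV κ Φ t p O.merged (gOf κ Φ t p O gv) (fOf κ Φ t p O fv) (cOf κ Φ t p O gv fv (cR2W mk)) (hOf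 κ Φ t p O gv fv (hFR mk))).cenS (x + stepVec (((1 : Fin 2), true) : MDir)) 0 - (fcellsV κ Φ t p O.merged (gOf κ Φ t p O gv) (fOf κ Φ t p O fv) (cOf κ Φ t p O gv fv (cR2W mk)) (hOf κ Φ t p O gv fv (hFR mk))).cenS x 0 + (bOf κ Φ t p O gv fv BSlot.small3) 0 - 1 ∧
      -(((fcellsV κ Φ t p O.merged (gOf κ Φ t p O gv) (fOf κ Φ t p O fv) (cOf κ Φ t p O gv fv (cR2W mk)) (hOf κ Φ t p O gv fv (hFR mk)))).hB 1 : ℤ) ≤ Skelφ.rdLo ((prFA κ Φ t p O.merged (gOf κ Φ t p O gv) (fOf κ Φ t p O fv))).A (nL κ Φ t p O.merged (gOf κ Φ t p O gv) (fOf κ Φ t p O fv)) (hL κ Φ t p O.merged (gOf κ Φ t p O gv) (fOf κ Φ t p O fv)) (vL κ Φ t p O.merged (gOf κ Φ t p O gv) (fOf κ Φ t p O fv)) (vβL κ Φ t p O.merged (gOf κ Φ t p O gv) (fOf κ Φ t p O fv)) ((prFA κ Φ t p O.merged (gOf κ Φ t p O gv) (fOf κ Φ t p O fv))).c₀ ((prFA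 κ Φ t p O.merged (gOf κ Φ t p O gv) (fOf κ Φ t p O fv))).c₁ ((prFA κ Φ t p O.merged (gOf κ Φ t p O gv) (fOf κ Φ t p O fv))).D (HK.kgLastLoY N) (HK.kgLastHiY N) 0 ∧
      Skelφ.rdHi ((prFA κ Φ t p O.merged (gOf κ Φ t p O gv) (fOf κ Φ t p O fv))).A (nL κ Φ t p O.merged (gOf κ Φ t p O gv) (fOf κ Φ t p O fv)) (hL κ Φ t p O.merged (gOf κ Φ t p O gv) (fOf κ Φ t p O fv)) (vL κ Φ t p O.merged (gOf κ Φ t p O gv) (fOf κ Φ t p O fv)) (vβL κ Φ t p O.merged (gOf κ Φ t p O gv) (fOf κ Φ t p O fv)) ((prFA κ Φ t p O.merged (gOf κ Φ t p O gv) (fOf κ Φ t p O fv))).c₀ ((prFA κ Φ t p O.merged (gOf κ Φ t p O gv) (fOf κ Φ t p O fv))).c₁ ((prFA κ Φ t p O.merged (gOf κ Φ t p O gv) (fOf κ Φ t p O fv))).D (HK.kgLastLoY N) (HK.kgLastHiY N) 0 ≤ (((fcellsV κ Φ t p O.merged (gOf κ Φ t p O gv) (fOf κ Φ t p O fv) (cOf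 κ Φ t p O gv fv (cR2W mk)) (hOf κ Φ t p O gv fv (hFR mk)))).hF 1 : ℤ)) := by
  have hN : EqNumL κ Φ t p O.merged (gOf κ Φ t p O gv) (fOf κ Φ t p O fv) := eqNumL_of_atQV hAt
  have hg : gFloorKG κ Φ t p O.merged mk ≤ gOf κ Φ t p O gv := (Hg O.merged).1
  have hg2 : 40 * Neg.K κ * KS0.R'0 κ Φ t p O.merged mk ≤ gOf κ Φ t p O gv := (Hg O.merged).2
  obtain ⟨hex1, hex2⟩ := HexY O.merged (gOf κ Φ t p O gv) (fOf κ Φ t p O fv)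
  rw [bOf_small3_eq, cOf_cR2W, hOf_hFR, RL_eq_RLD]
  -- abbreviate the merged record and the slot values
  generalize hD : O.merged = D at hN hg hg2 hex1 hex2 ⊢
  generalize hgg : gOf κ Φ t p O gv = g at hN hg hg2 hex1 hex2 ⊢
  generalize hff : fOf κ Φ t p O fv = f at hN hex1 hex2 ⊢
  have hexE := ex_le_Lp_US κ Φ t p D g f ex mx q
  refine ⟨0, kgqY κ Φ t p D g f (qxYQ4 κ Φ t p D g f), kgWY κ Φ t p D g f (WxYQ4 κ Φ t p D g f),
    kgYRows0_of κ Φ t p D g f mk (qxYQ4 κ Φ t p D g f) (WxYQ4 κ Φ t p D g f) hN hg,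
    kgNYv0 κ Φ t p D g f mk (qxYQ4 κ Φ t p D g f) (WxYQ4 κ Φ t p D g f),
    aWS κ Φ t p D g f (BSlot.small3 κ Φ t p D g f), BxS κ Φ t p D g f (BSlot.small3 κ Φ t p D g f), bLS κ Φ t p D g f (BSlot.small3 κ Φ t p D g f),
    ?_, ?_, ?_, hPRY_V' κ Φ t p D g f mk (cR2vW κ Φ t p D g f mk) hKq hN hg hg2, hLlY_W κ Φ t p D g f mk hKq hN hg hg2,
    ha_S κ Φ t p D g f (BSlot.small3 κ Φ t p D g f) hN, hBx_S κ Φ t p D g f (BSlot.small3 κ Φ t p D g f) hN, hb_S κ Φ t p D g f (BSlot.small3 κ Φ t p D g f),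
    (haW_b3 κ Φ t p D g f hN).1, (haW_b3 κ Φ t p D g f hN).2, hbq_b3 κ Φ t p D g f hN, ?_, fun x => hLtYV_Q hKq hN hg hg2 x⟩
  · -- hρ1: `r₀0 + 3 ≤ ex ≤ L′ ≤ E₀`
    exact le_trans hex1 (le_trans hexE.1 hexE.2)
  · -- hρ2: `13·((N+1)P + ZY₀ + ZY₁) ≤ ZDYW`, `ZDYW + 4 ≤ ex ≤ E₀`
    have hZ := reachY_le_ZDYW κ Φ t p D g f mk hKq hN hg hg2
    unfold kgR at hZ
    have h2 : ((ZDYW κ Φ t p D g f : ℕ) : ℤ) + 4 ≤ (Skelφ.Prm.E₀ (SUS ex mx κ Φ t p D g f q) : ℤ) := by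
      have := le_trans hex2 (le_trans hexE.1 hexE.2); exact_mod_cast this
    linarith
  · -- hρ3: `Rex ρ + r₀0 + 3 ≤ Rex ρ + ex ≤ cOffS + 2L′ + Rex ρ + 2 ≤ gap ρ`
    intro k
    have hR := hgapR_US κ Φ t p D g f ex mx q (Erad (Skelφ.Prm.gap (SUS ex mx κ Φ t p D g f q)) (fun _ => 0) (Skelφ.Prm.E₀ (SUS ex mx κ Φ t p D g f q)) k)
    have hRex : (SUS ex mx κ Φ t p D g f q).Rex = Rex κ Φ (mRS κ Φ t p D g f (mx κ Φ t p D g f)) q := (SUS_fields κ Φ t p D g f ex mx q).2.2.2.2.2.2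
    rw [hRex]
    have h1 := hexE.1
    omega
  · -- budget: `SchedYU.N = SchedY.N = N + 1 + m₁ + 1 + m₂ ≤ N + 1 + (m₁+1) + (m₂+1) ≤ LfQ`
    have hLen := kgSchedNY_le_LfQ3 κ Φ t p D g f mk (qxYQ4 κ Φ t p D g f) (WxYQ4 κ Φ t p D g f) hN hg (kgResY3_Q4 κ Φ t p D g f hN)
    have key : (kgNYv0 κ Φ t p D g f mk (qxYQ4 κ Φ t p D g f) (WxYQ4 κ Φ t p D g f)) + 1 +
          kgM₁Y (nL κ Φ t p D g f) (vL κ Φ t p D g f) (kgR κ Φ t p D mk) 0 (kgWY κ Φ t p D g f (WxYQ4 κ Φ t p D g f)) (kgNYv0 κ Φ t p D g f mk (qxYQ4 κ Φ t p D g f) (WxYQ4 κ Φ t p D g f)) + 1 +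
          kgM₂Y (nL κ Φ t p D g f) (ℓL κ Φ t p D g f) (hL κ Φ t p D g f) (vL κ Φ t p D g f) (kgR κ Φ t p D mk) 0 (kgqY κ Φ t p D g f (qxYQ4 κ Φ t p D g f)) (kgWY κ Φ t p D g f (WxYQ4 κ Φ t p D g f)) (kgNYv0 κ Φ t p D g f mk (qxYQ4 κ Φ t p D g f) (WxYQ4 κ Φ t p D g f)) ≤ LfQ κ.K₀ := by
      omega
    exact Eq.trans_le rfl key

end HY

end NegB

end PlanarSkeletonFrm

end Summit.CriticalPhenomena.PercolationContinuityZ3.Theorems.Transplant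

end
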